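import Summits.KontsevichZagierPeriods.KontsevichZagierPeriods.Theorems.SoloInformedNLAssembly
import Summits.KontsevichZagierPeriods.KontsevichZagierPeriods.Theorems.SoloInformedFlatConjecture
import HarnessLib
import HarnessLib.Audit

/-!
# SoloInformed — the summit in flat / stable-equidimensional form, unconditionally (THEOREM NF corollaries)

Solo programme `solo-KontsevichZagierPeriods-informed`, session s245 (K-NF complete: THEOREM NF is
the kernel theorem `soloInformed_nlElimination`, file 4c-ii-d4).

The corollaries of THEOREM NF that files 586 (`SoloInformedFlatTorsion`) and 588
(`SoloInformedFlatConjecture`) stated *granting* `SoloInformedNLElimination` are now unconditional: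

* `soloInformed_mem_relations_iff_totalFlat` — **torsion form of the KZ relations**:
  `x ∈ relations ↔ Φ_N x ∈ relations₁₂` for all large `N` (`Φ_N` = total flattening);
* `soloInformed_equivalent_iff_exists_flatIter` — **COROLLARY NF.1**: two representations of one
  dimension are KZ-equivalent iff after finitely many flattenings `× [0,1]` they are connected by
  equidimensional moves (additivity, algebraic change of variables) alone;
* `soloInformed_summit_iff_flatKZConjecture` — `KontsevichZagierPeriods ↔` the FLAT KZ conjecture
  (every null formal combination lies in `relations₁₂ ⊔ U`);
* `soloInformed_summit_iff_totalFlat` — **the summit in stable equidimensional form** (the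
  representation-level form of "KZP ⟺ the stable generalised Hilbert-third-problem statement for
  finite-volume `ℚ`-semialgebraic sets", `paper/VERDICT.md` §1): `KontsevichZagierPeriods ↔` every
  null formal combination `c` has `Φ_N c ∈ relations₁₂` for all large `N`;
* `soloInformed_summit_iff_sameDim_flatIter` — **the summit for pairs**: `KontsevichZagierPeriods ↔`
  any two rational representations of one dimension with the same value become
  `relations₁₂`-equivalent after finitely many flattenings.

No Newton–Leibniz / Stokes move appears on the right-hand sides.

References: this work (THEOREM NF and COROLLARIES NF.1–NF.2, `paper/nl-elimination.md` §2–§3);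
[Kontsevich–Zagier 2001, §1.2, Conjecture 1].
-/

noncomputable section

open scoped BigOperators

namespace Summit.KontsevichZagierPeriods.KontsevichZagierPeriods.Theorems

open Set MeasureTheory
open Literature.ModelTheory.ExponentialFields
open Literature.NumberTheory.Transcendental Literature.NumberTheory.Transcendental.KZ

variable {n : ℕ}

/-- **Torsion form of the KZ relations** (unconditional): `x ∈ relations` iff the total flattenings
`Φ_N x` lie in the equidimensional relations `relations₁₂` for all large `N`.
[this work, THEOREM NF + TORSION THEOREM] -/
theorem soloInformed_mem_relations_iff_totalFlat (x : FormalRep) :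
    x ∈ relations ↔ ∃ M, ∀ N, M ≤ N → soloInformedTotalFlat N x ∈ soloInformedEquidimRelations :=
  soloInformed_mem_relations_iff_totalFlat_of_nlElimination soloInformed_nlElimination x

/-- **COROLLARY NF.1** (unconditional): two representations of the same dimension are KZ-equivalent
iff after finitely many flattenings `× [0,1]` they are connected by equidimensional moves alone.
[this work, COROLLARY NF.1] -/
theorem soloInformed_equivalent_iff_exists_flatIter (r r' : IntegralRep n) :
    Equivalent r r' ↔ ∃ k, of (soloInformedFlatIter r k) - of (soloInformedFlatIter r' k) ∈
      soloInformedEquidimRelations :=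
  soloInformed_equivalent_iff_exists_flatIter_of_nlElimination soloInformed_nlElimination r r'

/-- **The summit is the FLAT KZ conjecture** (unconditional): `KontsevichZagierPeriods ↔` every
formal combination with value `0` lies in `relations₁₂ ⊔ U`.  [this work, THEOREM NF] -/
theorem soloInformed_summit_iff_flatKZConjecture :
    KontsevichZagierPeriods ↔ SoloInformedFlatKZConjecture :=
  soloInformed_summit_iff_flatKZConjecture_of_nlElimination soloInformed_nlElimination

/-- **The summit in stable equidimensional form** (unconditional): `KontsevichZagierPeriods ↔` every
null formal combination `c` has `Φ_N c ∈ relations₁₂` for all large `N`.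
[this work, COROLLARY NF.2] -/
theorem soloInformed_summit_iff_totalFlat :
    KontsevichZagierPeriods ↔
      ∀ c : FormalRep, eval c = 0 →
        ∃ M, ∀ N, M ≤ N → soloInformedTotalFlat N c ∈ soloInformedEquidimRelations :=
  soloInformed_summit_iff_totalFlat_of_nlElimination soloInformed_nlElimination

/-- **The summit for pairs** (unconditional): `KontsevichZagierPeriods ↔` any two rational
representations of the same dimension with the same value become connected by equidimensional moves
alone after finitely many flattenings `× [0,1]`.
[Kontsevich–Zagier 2001, §1.2, Conjecture 1; this work, COROLLARY NF.1] -/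
theorem soloInformed_summit_iff_sameDim_flatIter :
    KontsevichZagierPeriods ↔
      ∀ (n : ℕ) (r r' : IntegralRep n), r.IsRational → r'.IsRational → r.value = r'.value →
        ∃ k, of (soloInformedFlatIter r k) - of (soloInformedFlatIter r' k) ∈
          soloInformedEquidimRelations :=
  soloInformed_summit_iff_sameDim_flatIter_of_nlElimination soloInformed_nlElimination

end Summit.KontsevichZagierPeriods.KontsevichZagierPeriods.Theorems
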